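import Summits.HodgeConjecture.CorCM.AndreSplitWeilTypeTwist
import Summits.HodgeConjecture.CorCM.Milne2020OfRiemannOnly
import Summits.HodgeConjecture.CorCM.AndreTargetsOfRiemann
import Summits.HodgeConjecture.CorCM.EndAlgebraStructure
import Literature.AlgebraicGeometry.HodgeTheory.AbelianVarietyHodgeFullnessHolds
import HarnessLib

/-!
# COR-CM (cell `pub-hodgecm2`), André 1992 in Milne's SPLIT form (3/3) — the Literature record
# `HodgeTheory.Andre1992_hodgeClasses_cmType_mem_span_pullback_splitWeilClassesCM` HOLDS

Literature seat `lit-milne` (gen 56), count-neutral for the binder table; THEOREMS ONLY (no definition, no named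
fact, D-0026). HONEST FRAMING: this file discharges the named fact
`Literature.AlgebraicGeometry.HodgeTheory.Andre1992_hodgeClasses_cmType_mem_span_pullback_splitWeilClassesCM`
(`WeilClassesCMReductionSplit`; André 1992 = Milne 2020 Thm. 1 with its proof, Charles–Schnell Thm. 11.5.21: on a complex
abelian variety of CM type every Hodge class of positive codimension `p` is a `ℂ`-combination of pull-backs along
homomorphisms `A ⟶ B` of rational `(p,p)` Weil classes of abelian varieties `B` OF CM TYPE and OF SPLIT WEIL TYPE
relative to ONE Galois CM field `E ≅ ℚ[T]/(R(T²))`, of `E`-rank `2p`) by a hypothesis-free theorem,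
`andre1992_hodgeClasses_cmType_mem_span_pullback_splitWeilClassesCM_holds`. NO case of the Hodge conjecture is proved:
`HC_CM` appears only in `hc_cm_of_splitWeilClassesCM`, under the displayed binder `hW` (algebraicity of the Weil classes
at the CM points of the split components — open beyond the known cases).

The proof follows Milne, arXiv:2010.08857, §3 (proof of Thm. 1) and Deligne, LNM 900 §5 (c), on the cell's kernel
theorems: the domination of `A` by a biproduct of realisations of CM types of one Galois CM field `F ⊇ ℚ(ζ₅)`,
`[F:ℚ] > 2` (`AndreRiemann.exists_avDominatedBy_biproduct_realisations_of_riemann'`; Riemann's theorem is the tree's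
`deligneMilne1982_Thm_6_20_full_holds`), André's product form on it
(`AndreProductForm.andre1992_hodgeClasses_cmTypedProduct_mem_span_pullback_weilLines_holds`) — exactly as in the cell's
`Milne2020.milne2020_of_avDominatedBy_biproduct`, whose targets are the admissible twisted slot products
`A_Δ = ⨁_{j<2p} A'_{i_j}` with CONSTANT SUM `p` —, Deligne's presentation at a purely imaginary separating `b₀ ∈ 𝓞_F`
fixed once (`AndreSplitWeilTypeGenerator`), and the SPLIT Weil type of `(A_Δ, ⊕ act_j(b₀))`
(`AndreSplitWeilTypeTwist.isSplitWeilTypeCM_of_constantSum`); the targets are of CM type by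
`CMProductEnd.isOfCMType_biproduct_fin_iff`, and `weilLineClasses ≤ weilClassesField` (`Milne2020.weilLineClasses_le_weilClassesField`).

* `andre1992_split_of_avDominatedBy_biproduct` — the assembly from a domination;
* `andre1992_split_two_lt_of_riemann`, `andre1992_split_of_riemann` — modulo Riemann's theorem `hRi` alone (with the
  degree bound `2e₀ > 2`);
* `andre1992_hodgeClasses_cmType_mem_span_pullback_splitWeilClassesCM_holds` — THE RECORD HOLDS;
* `hc_cm_of_splitWeilClassesCM (hW) : HC_CM` — André's reduction in its printed precision (Markman: «André reduced the
  Hodge conjecture for abelian varieties of CM-type to the question of algebraicity of the Weil classes on abelian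
  varieties of split Weil type»), sharpening the cell's `Milne2020.hc_cm_of_weilClassesField_galois_of_riemann_only`.

## References
* [Andre1992HodgeCM] Y. André, *Une remarque à propos des cycles de Hodge de type CM* (1992), Théorème, p. 2.
* [Milne2020HodgeClassesAV] J. S. Milne, arXiv:2010.08857, §3 Thm. 1 and proof.
* [Deligne1982HodgeCycles] P. Deligne (notes by J. S. Milne), LNM 900 (1982), §4 Cor. 4.2; §5 (c) pp. 38–39.
* [CharlesSchnell2014Notes] F. Charles, C. Schnell (2014), Thm. 11.5.21, Prop. 11.5.22.
* [DeligneMilne1982Tannakian] P. Deligne, J. S. Milne, *Tannakian categories*, LNM 900, §6 Thm. 6.20.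
* [Markman2025SurveySecant] E. Markman, arXiv:2509.23403, §1.1.
* [Milne1999] J. S. Milne, *Lefschetz motives and the Tate conjecture*, Compositio Math. 117 (1999), §7 p. 72.
-/

noncomputable section

namespace Summit.HodgeConjecture.CorCM.AndreSplit

open CategoryTheory CategoryTheory.Limits Polynomial NumberField
open Literature.AlgebraicTopology.SingularHomology
open Literature.AlgebraicGeometry Literature.AlgebraicGeometry.Motives Literature.AlgebraicGeometry.HodgeTheory
open Literature.AlgebraicGeometry.ComplexMultiplication Literature.AlgebraicGeometry.Deligne1982
open Literature.AlgebraicGeometry.Milne1999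
open Summit.HodgeConjecture.CorCM.AndreProductForm Summit.HodgeConjecture.CorCM.Milne2020
open Summit.HodgeConjecture.CorCM.Domination Summit.HodgeConjecture.CorCM.AndreRiemann

/-! ## The assembly: the record HOLDS, and `HC_CM` from the Weil classes of the split CM components -/

section Assembly

open Literature.NumberTheory.Automorphic

open scoped Classical in
/-- **André's theorem in Milne's SPLIT form, from a domination by a biproduct of realisations** (the assembly of
`Milne2020.milne2020_of_avDominatedBy_biproduct`, with the targets' printed attributes restored). If `A` is dominated
(`s ≫ π = [N]`, `N ≠ 0`) by `⨁_j A'_j`, the `A'_j` realising CM types `Ψ_j` of a Galois CM field `F` with `[F:ℚ] > 2`, and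
`b₀ ∈ 𝓞_F` is purely imaginary separating with `R(T²) = minpoly_ℤ(b₀)`, then for `p > 0` every rational `(p,p)` class on
`A` lies in the `ℂ`-span of `splitWeilClassPullbacksCM A R e₀ p`: André's product form
(`AndreProductForm.andre1992_hodgeClasses_cmTypedProduct_mem_span_pullback_weilLines_holds`) on `π^* c`, pushed back by
`s^*`; each generator `f_Δ^* t` goes to `(s ≫ f_Δ)^* t` with target `A_Δ = ⨁_j A'_{i_j}` (twisted slot actions) OF CM TYPE
(`CMProductEnd.isOfCMType_biproduct_fin_iff`) and OF SPLIT WEIL TYPE relative to `E = ℚ(b₀) ≅ ℚ[T]/(R(T²))`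
(`isSplitWeilTypeCM_of_constantSum`, the constant sum being André's admissibility of `Δ`), and
`t ∈ weilLineClasses ≤ weilClassesField (⨁ A_Δ) (act b₀) (R(T²))` (`Milne2020.weilLineClasses_le_weilClassesField`).
[cite: Milne2020HodgeClassesAV, §3 Thm. 1 (proof: «A_Δ has complex multiplication by F^Δ … of split Weil type relative to F»)]
[cite: Andre1992HodgeCM, Théorème] [cite: Deligne1982HodgeCycles, §5 (c)] -/
theorem andre1992_split_of_avDominatedBy_biproduct {F : Type} [Field F] [NumberField F] [IsCMField F]
    [IsGalois ℚ F] (hF2 : 2 < Module.finrank ℚ F) {n : ℕ} {A' : Fin n → AbelianVariety ℂ} {Ψ : Fin n → CMType F}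
    {ι' : ∀ j, 𝓞 F →+* End (A' j)} {θ' : ∀ j, F →+* Module.End ℂ (complexBetti (A' j).X 1)}
    (hA' : ∀ j, IsCMTypeRealisation (Ψ j) (A' j) (ι' j) (θ' j)) {A : AbelianVariety ℂ}
    (hdom : AVDominatedBy A (⨁ A')) {b₀ : 𝓞 F} (hb₀ : IsCMField.complexConj F (b₀ : F) = -(b₀ : F))
    (hsep : Function.Injective fun σ : F →+* ℂ => σ (b₀ : F))
    {R : Polynomial ℤ} {e₀ : ℕ} (he : Module.finrank ℚ F = 2 * e₀) (hRm : R.Monic) (hRdeg : R.natDegree = e₀)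
    (hR : R.comp (X ^ 2) = minpoly ℤ b₀) (hirr : Irreducible (cmPolyQ R))
    (hroots : ∀ s : ℂ, Polynomial.eval₂ (Int.castRingHom ℂ) s R = 0 → s.im = 0 ∧ s.re < 0)
    (haev : Polynomial.aeval (b₀ : F) (cmPolyQ R) = 0) (hdegQ : (cmPolyQ R).natDegree = Module.finrank ℚ F)
    {p : ℕ} (hp : 0 < p) (c : complexBetti A.X (2 * p))
    (hcQ : IsRationalClass c) (hcH : IsOfHodgeType A.dim A.X (2 * p) p p c) :
    c ∈ Submodule.span ℂ (splitWeilClassPullbacksCM A R e₀ p) := by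
  obtain ⟨s, π, N, hN, hsπ⟩ := hdom
  -- André's product form on `⨁ A'` applied to `π^* c`
  have hc₁ := HodgeTheory.AbelianVariety.mapsTo_hodgeClasses π p ⟨hcQ, hcH⟩
  have handre := andre1992_hodgeClasses_cmTypedProduct_mem_span_pullback_weilLines_holds F n A' Ψ ι' θ'
    hA' p (complexBetti.map π.hom.hom.hom (2 * p) c) hc₁.1 hc₁.2
  -- push through the domination: `s^* (π^* c) = N^{2p} • c`
  set L : complexBetti (⨁ A').X (2 * p) →ₗ[ℂ] complexBetti A.X (2 * p) :=
    (complexBetti.map s.hom.hom.hom (2 * p)).hom with hL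
  have hLc : L (complexBetti.map π.hom.hom.hom (2 * p) c) = ((N : ℂ) ^ (2 * p)) • c :=
    complexBetti_map_map_of_comp_eq_nsmul_id hsπ (2 * p) c
  have hmem := Submodule.apply_mem_span_image_of_mem_span L handre
  rw [hLc] at hmem
  have hNC : ((N : ℂ) ^ (2 * p)) ≠ 0 := pow_ne_zero _ (Nat.cast_ne_zero.mpr hN)
  rw [← inv_smul_smul₀ hNC c]
  refine Submodule.smul_mem _ _ (Submodule.span_mono ?_ hmem)
  -- the image of André's generators lies in the record's `splitWeilClassPullbacksCM`
  rintro _ ⟨c', ⟨i, e, t, -, hcs, htQ, htH, htW, rfl⟩, rfl⟩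
  let Bs : Fin (2 * p) → AbelianVariety ℂ := fun j => A' (i j)
  let act : ∀ j, 𝓞 F →+* End (Bs j) := fun j =>
    (ι' (i j)).comp (RingOfIntegers.mapRingEquiv (e j).symm).toRingHom
  have hBs : ∀ j, IsCMTypeRealisation (PicardCM.CMCode.cmTypeMap (e j) (Ψ (i j))) (Bs j) (act j)
      ((θ' (i j)).comp (e j).symm.toRingHom) := fun j => slot_isCMTypeRealisation (hA' (i j)) (e j)
  have hnc : ∀ P : Fin (2 * p) → Prop, (Finset.univ.filter P).card = {j | P j}.ncard := by
    intro P
    rw [Set.ncard_eq_toFinset_card', Set.toFinset_setOf]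
  have hadm : ∀ σ : F →+* ℂ,
      (Finset.univ.filter fun j : Fin (2 * p) => σ ∈ (PicardCM.CMCode.cmTypeMap (e j) (Ψ (i j))).1).card = p :=
    fun σ => (hnc _).trans (hcs σ)
  have hSplit := isSplitWeilTypeCM_of_constantSum F hF2 rfl hp Bs act hBs hadm hb₀ hsep he hRm hRdeg hR hirr hroots
    haev hdegQ
  have hCM : IsOfCMType (⨁ Bs) := (CMProductEnd.isOfCMType_biproduct_fin_iff Bs).2 fun j => (hBs j).isOfCMType
  refine ⟨⨁ Bs, s ≫ multiDiagonal A' i, diagHom F Bs act b₀, t, hCM, hSplit, ?_, htQ, htH, ?_⟩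
  · rw [hR]
    exact weilLineClasses_le_weilClassesField F Bs act b₀ (2 * p) htW
  · rw [complexBetti_map_comp_hom]
    rfl

/-- **André 1992 in Milne's split form — working form with the degree bound `[F:ℚ] = 2e₀ > 2`, modulo Riemann's
theorem.** For every complex abelian variety `A` of CM type there is ONE Galois CM field polynomial `R(T²)` of degree
`2e₀ > 2` (Deligne's presentation of the common Galois CM field `F ⊇ ℚ(ζ₅)` of a dominating biproduct of realisations,
`AndreRiemann.exists_avDominatedBy_biproduct_realisations_of_riemann'`, at a purely imaginary separating integer) such that
for every `p > 0` every rational `(p,p)` class on `A` is a `ℂ`-combination of pull-backs along homomorphisms `A ⟶ B` of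
rational `(p,p)` Weil classes of abelian varieties `B` OF CM TYPE and OF SPLIT WEIL TYPE relative to `ℚ[T]/(R(T²))` of
`E`-rank `2p`. [cite: Milne2020HodgeClassesAV, §3 Thm. 1 and proof] [cite: Andre1992HodgeCM, Théorème]
[cite: DeligneMilne1982Tannakian, §6 Thm. 6.20 (Riemann)] -/
theorem andre1992_split_two_lt_of_riemann (hRi : DeligneMilne1982_Thm_6_20_full) (A : AbelianVariety ℂ)
    (hCM : IsOfCMType A) :
    ∃ (R : Polynomial ℤ) (e₀ : ℕ), IsGaloisCMFieldPoly (R.comp (X ^ 2)) (2 * e₀) ∧ 2 < 2 * e₀ ∧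
      ∀ (p : ℕ), 0 < p → ∀ (c : complexBetti A.X (2 * p)), IsRationalClass c →
        IsOfHodgeType A.dim A.X (2 * p) p p c → c ∈ Submodule.span ℂ (splitWeilClassPullbacksCM A R e₀ p) := by
  obtain ⟨F, _instF, _instNF, _instCM, hGal, h2, n, B, Φ, ι, θ, hB, hdom⟩ :=
    exists_avDominatedBy_biproduct_realisations_of_riemann' hRi A hCM
  haveI : IsGalois ℚ F := hGal
  obtain ⟨b₀, hb₀, hsep⟩ := exists_imaginary_separating F
  obtain ⟨R, e₀, he, hRm, hRdeg, hR, hirr, hroots, haev, hdegQ, hGalP⟩ := exists_sq_eq_minpoly hb₀ hsep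
  exact ⟨R, e₀, hGalP, he ▸ h2, fun p hp c hcQ hcH =>
    andre1992_split_of_avDominatedBy_biproduct h2 hB hdom hb₀ hsep he hRm hRdeg hR hirr hroots haev hdegQ hp c
      hcQ hcH⟩

/-- **The Literature record `HodgeTheory.Andre1992_hodgeClasses_cmType_mem_span_pullback_splitWeilClassesCM` (André 1992
= Milne 2020 Thm. 1 with its proof, faithful split form) HOLDS modulo Riemann's theorem `hRi` (row B02) alone.**
[cite: Milne2020HodgeClassesAV, §3 Thm. 1] [cite: Andre1992HodgeCM, Théorème] [cite: DeligneMilne1982Tannakian, §6 Thm. 6.20] -/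
theorem andre1992_split_of_riemann (hRi : DeligneMilne1982_Thm_6_20_full) :
    Andre1992_hodgeClasses_cmType_mem_span_pullback_splitWeilClassesCM := fun A hCM =>
  let ⟨R, e₀, hP, _, h⟩ := andre1992_split_two_lt_of_riemann hRi A hCM
  ⟨R, e₀, hP, h⟩

/-- **The Literature record `HodgeTheory.Andre1992_hodgeClasses_cmType_mem_span_pullback_splitWeilClassesCM` HOLDS**
(hypothesis-free: Riemann's theorem is the tree's theorem `deligneMilne1982_Thm_6_20_full_holds`). On every complex
abelian variety of CM type, every Hodge class of positive codimension `p` is a `ℂ`-combination of pull-backs `g^*(w)` along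
homomorphisms `g : A ⟶ B` of rational `(p,p)` Weil classes `w ∈ W_E(B) ⊗ ℂ`, with ONE Galois CM field
`E ≅ ℚ[T]/(R(T²))` and every `B` of CM type and of SPLIT Weil type relative to `E`, of `E`-rank `2p`. This discharges the
named fact; users' `(h : Andre1992_hodgeClasses_cmType_mem_span_pullback_splitWeilClassesCM)` are fed this theorem.
No case of the Hodge conjecture is proved here. [cite: Andre1992HodgeCM, Théorème] [cite: Milne2020HodgeClassesAV, §3 Thm. 1 and proof]
[cite: Deligne1982HodgeCycles, §4 Cor. 4.2, §5 (c)] [cite: CharlesSchnell2014Notes, Thm. 11.5.21, Prop. 11.5.22] -/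
theorem andre1992_hodgeClasses_cmType_mem_span_pullback_splitWeilClassesCM_holds :
    Andre1992_hodgeClasses_cmType_mem_span_pullback_splitWeilClassesCM :=
  andre1992_split_of_riemann deligneMilne1982_Thm_6_20_full_holds

/-- **`HC_CM` from the algebraicity of the Weil classes at the CM points of the SPLIT `(E, 2p)`-components of the Galois
CM fields — no record.** If for every Galois CM field `E ≅ ℚ[T]/(R(T²))` the rational `(p,p)` classes of
`weilClassesField B η (R(T²)) (2p)` are algebraic on every complex abelian variety `B` OF CM TYPE and of SPLIT Weil type
relative to `E` of `E`-rank `2p` (binder `hW` — open beyond the known cases, taken as a hypothesis), then the Hodge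
conjecture holds for all complex abelian varieties of CM type (`HC_CM`): the tree's `cmHodgeHypothesisAt_of_andre1992_split`
fed with `andre1992_hodgeClasses_cmType_mem_span_pullback_splitWeilClassesCM_holds`. This sharpens the cell's
`Milne2020.hc_cm_of_weilClassesField_galois_of_riemann_only` (all Weil-type targets) to the printed SPLIT CM targets
(Markman: «André reduced the Hodge conjecture for abelian varieties of CM-type to the question of algebraicity of the Weil
classes on abelian varieties of split Weil type»). [cite: Andre1992HodgeCM, p. 2 and Théorème]
[cite: Milne2020HodgeClassesAV, §3 Thm. 1] [cite: Markman2025SurveySecant, §1.1 (before Thm. 1.4)] [cite: Milne1999, §7 p. 72 (hypothesis (H))] -/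
theorem hc_cm_of_splitWeilClassesCM
    (hW : ∀ (R : Polynomial ℤ) (e₀ : ℕ), IsGaloisCMFieldPoly (R.comp (Polynomial.X ^ 2)) (2 * e₀) →
      ∀ (B : AbelianVariety ℂ) (η : B ⟶ B) (p : ℕ), Milne1999.IsOfCMType B →
        IsSplitWeilTypeCM B η R e₀ p →
          ∀ w ∈ weilClassesField B η (R.comp (Polynomial.X ^ 2)) (2 * p), IsRationalClass w →
            IsOfHodgeType B.dim B.X (2 * p) p p w → w ∈ algebraicClasses B.X p) :
    HC_CM :=
  hc_cm_iff_forall_cmHodgeHypothesisAt.mpr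
    (cmHodgeHypothesisAt_of_andre1992_split andre1992_hodgeClasses_cmType_mem_span_pullback_splitWeilClassesCM_holds hW)

end Assembly

end Summit.HodgeConjecture.CorCM.AndreSplit

end
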